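import Literature.MathematicalPhysics.KineticTheory.CellChain

/-!
# Inhomogeneous chains with two bath couplings; chain environments and the one-site bath map

Topic `Literature/MathematicalPhysics/KineticTheory`, grouping namespace `…KineticTheory.HeatConduction`
of `FouriersLaw.lean` (`OscillatorChain`) and `CellChain.lean` (`SiteChain`). Definition request
`defn-InhomogeneousChainEnvironment` (route `AtomisticToContinuum/FouriersLaw/Theses/BathRenormalisation`:
foreseen children JunctionLocality / InsertionCostLowerBound of ParabolicGerm stmt-3320 and
ResistanceQuantum stmt-3321; card `Ideas/_closed/bath-renormalisation-parabolic-fixed-point.md`).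

## Sources

* Bonetto–Lebowitz–Rey-Bellet 2000, §3 eq. (8) (crystal Hamiltonian, site-dependent pinning `U_i`),
  §4.1 eq. (10): the boundary sites carry Ornstein–Uhlenbeck reservoirs with THEIR OWN couplings,
  `m ṗ_i = -∇_{q_i}𝒱 - λ_α p_i/m + (2 λ_α T_α)^{1/2} ξ_α`, `α ∈ {L, R}`; §5.2 eq. (23) bond current;
  §5.3 eq. (31)–(33) (`T = (T_L+T_R)/2`, `δT = T_L - T_R`, `κ = lim_L L lim_{δT→0} J̃/δT`).
* Cuneo–Eckmann–Hairer–Rey-Bellet 2018, §2 eq. (2.1)–(2.2), §3 eq. (3.1)–(3.2): oscillator NETWORKS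
  (vertex potentials `U_v`, edge potentials `V_e`, baths `(γ_b, T_b)`, `b ∈ B`), generator
  `L = ∑_v (p_v ∂_{q_v} - ∂_{q_v}H ∂_{p_v}) + ∑_b γ_b (T_b ∂²_{p_b} - p_b ∂_{p_b})`; a path with baths
  at both ends satisfies their condition C1 (steady state: Thm 2.13 under C1–C5, not vendored here).
* Dhar 2008, §4.1 (display after eq. (52)): at the harmonic level one more site is one more transfer
  matrix, `D̂ = T̂_1 T̂_2 ⋯ T̂_N`, the baths entering only through the self-energy `Σ'` — the linear
  model of the recursion `Φ` below.

## Contents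

(A) `InhomogeneousChain N` (site data `U i`, bond data `V i` for the bond `(i, i+1)`, bath couplings
`γL` on site `0`, `γR` on site `N - 1`) with `hamiltonian/generator/bondCurrent/totalCurrent/
IsSteadyState` written as `OscillatorChain.*`/`SiteChain.*` except that each bath term carries its
own coupling (BLR (10)); embeddings `SiteChain.toInhomogeneous` (restriction, `γL = γR = γ`) and
`OscillatorChain.toInhomogeneous` (constant data): Hamiltonian/currents agree by `rfl`, the
generator by the proved `toInhomogeneous_generator`, steady states by `toInhomogeneous_isSteadyState`.

(B) PORT VOCABULARY of the bath-renormalisation map (card § Mechanism; route, DEFINITION REQUESTS):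
`ChainEnvironment` (`k` sites, far site `k-1` on a Langevin bath `γ`, site `0` the port), `bath γ`
(`k = 0`, the `B_R` of the card), `attach U₀ V₀` (the bath map `Φ`: one new port site `U₀` bonded
to the old port through `V₀`), `standard U₀ V₀ γ k`, `realiseWithContact γc` (a Langevin CONTACT put
directly on the port site), `composite U₀ V₀ γc E = [contact γc]–[site U₀]–V₀–E`, the one-site
conductance functional as a predicate `HasConductance U₀ V₀ γc T E g` over ALL steady-state families
of the composite (no existence/uniqueness presupposed, cf. `OscillatorChain.FouriersLawFor`), the
standard-head predicate `IsStandardUpTo` and the class `nearlyClosed U₀ V₀ γc T m g₀` (`𝔅_T^{m,g₀}`).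
ORBIT IDENTITY: `(attach U₀ V₀)^[n] (bath γ) = standard U₀ V₀ γ n` (`iterate_attach_bath`) and
`(standard P.U P.V P.γ n).composite P.U P.V P.γ = P.toInhomogeneous (n+1)` (`composite_standard`), so
along the orbit `HasConductance` unfolds (`hasConductance_standard_iff`) to the conductance
`G_{n+1} = lim_δ totalCurrent/(n δ)` at `T ± δ/2` of the homogeneous `(n+1)`-chain `P` — for
`P = pinnedChain ω₂ lam β γ` literally the `G_N = D_N/(N-1)`, `N = n+1`, of the route's items.

## Design choices

* Temperatures are arguments of `generator/IsSteadyState` (as for `OscillatorChain`), so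
  `realiseWithContact/composite` take only the contact coupling, and "environment at `T`, contact
  biased by `δ`" is the choice of bath temperatures inside `HasConductance`: the bias is split
  SYMMETRICALLY (`T ± δ/2`, BLR (31)–(32)) and the current is the bond-AVERAGED one, `totalCurrent/k`,
  which makes the orbit identity literal. In a steady state every bond current equals the port
  current `J̃` (BLR §5.2 (24)–(27)), but the weak formulation `IsSteadyState` does not hand this over
  for free, so the averaged form is the one that glues without a further lemma. For the bare bath
  (`k = 0`: one site, no bond) the quotient is the junk `0/0 = 0` (`hasConductance_bath`); the route
  evaluates `g` only at `k ≥ 1` (`N ≥ 2`).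
* Data are `Fin`-indexed; the number of sites is a FIELD of `ChainEnvironment` (so that `attach` is a
  self-map, iterates by `Nat.iterate`, and the orbit identity is a literal equality of environments),
  while chains carry their length as a parameter (`PhaseSpace N`). No positivity fields: `γ, γL, γR`
  are real numbers like `OscillatorChain.γ`; `0 < E.γ` is part of the class `nearlyClosed`.
* NOT here: the semi-infinite chain seen from its end (`B*`) or any path-space dynamics (a separate
  long-horizon notion); existence/uniqueness facts for inhomogeneous chains. Searched (`lean search`):
  `InhomogeneousChain`, `ChainEnvironment`, `toInhomogeneous`, `Environment` — nothing in Mathlib or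
  Literature besides `SiteChain` (one coupling, `ℕ`-indexed), which embeds here.
-/

noncomputable section

open MeasureTheory Filter Topology
open scoped ContDiff

namespace Literature.MathematicalPhysics.KineticTheory.HeatConduction

/-! ### (A) Inhomogeneous chains with two bath couplings -/

/-- A chain of `N` unit-mass oscillators with site-dependent pinning `U i`, bond-dependent
interaction `V i` (bond `(i, i+1)`), and Langevin baths of couplings `γL` on site `0` and `γR` on
site `N - 1`: Bonetto–Lebowitz–Rey-Bellet's crystal (8) (`d = 1`, `m = 1`, site-dependent `U_i`)
with the Ornstein–Uhlenbeck reservoirs (10) of couplings `λ_L, λ_R`; equivalently the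
Cuneo–Eckmann–Hairer–Rey-Bellet network on the path graph `{0, …, N-1}` with `B = {0, N-1}`. As
for `OscillatorChain`, every `N` is allowed: for `N = 1` both baths act on the single site, `N = 0`
is the empty chain. [Cuneo–Eckmann–Hairer–Rey-Bellet 2018, §2 eq. (2.1)–(2.2)]
[cite: BonettoLebowitzReyBellet2000, §3 eq. (8) and §4.1 eq. (10)] -/
@[ext]
structure InhomogeneousChain (N : ℕ) where
  /-- the pinning (on-site) potential `U i` of site `i` -/
  U : Fin N → ℝ → ℝ
  /-- the interaction potential `V i` of the bond `(i, i+1)` (the last entry is not used) -/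
  V : Fin N → ℝ → ℝ
  /-- coupling `λ_L` of the Langevin bath acting on site `0` -/
  γL : ℝ
  /-- coupling `λ_R` of the Langevin bath acting on site `N - 1` -/
  γR : ℝ

namespace InhomogeneousChain

variable {N : ℕ} (C : InhomogeneousChain N)

/-- `H(q, p) = ∑_i (p_i²/2 + U_i(q_i)) + ∑_{bonds (i, i+1)} V_i(q_{i+1} - q_i)` — the formula of
`OscillatorChain.hamiltonian` with site/bond data. [cite: BonettoLebowitzReyBellet2000, §3 eq. (8)] -/
def hamiltonian (x : PhaseSpace N) : ℝ :=
  (∑ i, (x.2 i ^ 2 / 2 + C.U i (x.1 i))) +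
    ∑ i : Fin N, ∑ j : Fin N, if j.val = i.val + 1 then C.V i (x.1 j - x.1 i) else 0

/-- The generator with baths `(γL, T_L)` on site `0` and `(γR, T_R)` on site `N - 1`:
`L f = ∑_i (p_i ∂_{q_i} f - ∂_{q_i}H ∂_{p_i} f) + ∑_{i = 0} γL (T_L ∂²_{p_i} f - p_i ∂_{p_i} f) + ∑_{i = N-1} γR (T_R ∂²_{p_i} f - p_i ∂_{p_i} f)`
(BLR (10) with `m_i = 1`; CEHR (3.1)–(3.2) with `B = {0, N-1}`).
[Cuneo–Eckmann–Hairer–Rey-Bellet 2018, §3 eq. (3.1)–(3.2)] [cite: BonettoLebowitzReyBellet2000, §4.1 eq. (10)] -/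
def generator (T_L T_R : ℝ) (f : PhaseSpace N → ℝ) (x : PhaseSpace N) : ℝ :=
  (∑ i, (x.2 i * partialQ i f x - partialQ i C.hamiltonian x * partialP i f x)) +
    ∑ i : Fin N,
      ((if i.val = 0 then C.γL * (T_L * partialP i (partialP i f) x - x.2 i * partialP i f x)
          else 0) +
        (if i.val = N - 1 then C.γR * (T_R * partialP i (partialP i f) x - x.2 i * partialP i f x)
          else 0))

/-- The energy current through the bond `(i, i+1)`, `j_i = -½ (p_i + p_{i+1}) V_i'(q_{i+1} - q_i)`
(`0` at the last site) — `OscillatorChain.bondCurrent` with the bond's own potential.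
[cite: BonettoLebowitzReyBellet2000, §5.2 eq. (23)] -/
def bondCurrent (i : Fin N) (x : PhaseSpace N) : ℝ :=
  ∑ j : Fin N, if j.val = i.val + 1 then
    -((x.2 i + x.2 j) / 2 * deriv (C.V i) (x.1 j - x.1 i)) else 0

/-- The space-summed mean current `∑_{bonds} ∫ j_i dμ` (`= (N-1) J̃` in a steady state).
[cite: BonettoLebowitzReyBellet2000, §5.2 eq. (24)-(27)] -/
def totalCurrent (μ : Measure (PhaseSpace N)) : ℝ :=
  ∑ i : Fin N, ∫ x, C.bondCurrent i x ∂μ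

/-- `C.IsSteadyState T_L T_R μ`: `μ` is a probability measure solving the stationary Fokker–Planck
equation weakly (`∫ L f dμ = 0`, `f` smooth compactly supported) with integrable bond currents —
`OscillatorChain.IsSteadyState` verbatim. [cite: BonettoLebowitzReyBellet2000, §5.1] -/
def IsSteadyState (T_L T_R : ℝ) (μ : Measure (PhaseSpace N)) : Prop :=
  IsProbabilityMeasure μ ∧
    (∀ f : PhaseSpace N → ℝ, ContDiff ℝ ∞ f → HasCompactSupport f →
      ∫ x, C.generator T_L T_R f x ∂μ = 0) ∧
    ∀ i : Fin N, Integrable (C.bondCurrent i) μ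

/-- `L 1 = 0` (no zeroth-order term). [folklore] -/
@[simp] theorem generator_const (T_L T_R c : ℝ) (x : PhaseSpace N) :
    C.generator T_L T_R (fun _ => c) x = 0 := by
  simp [generator, partialQ, partialP]

/-- The empty chain carries no current. [folklore] -/
@[simp] theorem totalCurrent_zero (C : InhomogeneousChain 0) (μ : Measure (PhaseSpace 0)) :
    C.totalCurrent μ = 0 := by
  simp [totalCurrent]

/-- `N = 0`: every probability measure on the one-point phase space is a steady state. [folklore] -/
theorem isSteadyState_zero (C : InhomogeneousChain 0) (T_L T_R : ℝ) (μ : Measure (PhaseSpace 0))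
    [IsProbabilityMeasure μ] : C.IsSteadyState T_L T_R μ := by
  refine ⟨inferInstance, fun f _ _ => ?_, fun i => i.elim0⟩
  simp [generator]

end InhomogeneousChain

/-! ### Embeddings of `SiteChain` (restriction) and `OscillatorChain` (constant data) -/

namespace SiteChain

/-- The `N`-site restriction of `ℕ`-indexed site data, both baths with coupling `γ`. [folklore] -/
def toInhomogeneous (P : SiteChain) (N : ℕ) : InhomogeneousChain N :=
  ⟨fun i => P.U i, fun i => P.V i, P.γ, P.γ⟩

variable (P : SiteChain) (N : ℕ)

/-- Left coupling of the restriction. [folklore] -/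
@[simp] theorem toInhomogeneous_γL : (P.toInhomogeneous N).γL = P.γ := rfl
/-- Right coupling of the restriction. [folklore] -/
@[simp] theorem toInhomogeneous_γR : (P.toInhomogeneous N).γR = P.γ := rfl

/-- Same Hamiltonian, definitionally. [folklore] -/
@[simp] theorem toInhomogeneous_hamiltonian : (P.toInhomogeneous N).hamiltonian = P.hamiltonian N :=
  rfl

/-- Same bond currents, definitionally. [folklore] -/
@[simp] theorem toInhomogeneous_bondCurrent : (P.toInhomogeneous N).bondCurrent = P.bondCurrent N :=
  rfl

/-- Same total current, definitionally. [folklore] -/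
@[simp] theorem toInhomogeneous_totalCurrent (μ : Measure (PhaseSpace N)) :
    (P.toInhomogeneous N).totalCurrent μ = P.totalCurrent μ := rfl

/-- Same generator: `γ ∑_b (…) = ∑_b γ (…)`. [folklore] -/
@[simp] theorem toInhomogeneous_generator : (P.toInhomogeneous N).generator = P.generator N := by
  funext T_L T_R f x
  simp only [InhomogeneousChain.generator, SiteChain.generator, toInhomogeneous_hamiltonian,
    toInhomogeneous_γL, toInhomogeneous_γR, Finset.mul_sum, mul_add, mul_ite, mul_zero]

/-- Same steady states. [folklore] -/
theorem toInhomogeneous_isSteadyState_iff (T_L T_R : ℝ) (μ : Measure (PhaseSpace N)) :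
    (P.toInhomogeneous N).IsSteadyState T_L T_R μ ↔ P.IsSteadyState N T_L T_R μ := by
  simp only [InhomogeneousChain.IsSteadyState, SiteChain.IsSteadyState, toInhomogeneous_generator,
    toInhomogeneous_bondCurrent]

/-- Same steady-state predicate (as functions). [folklore] -/
@[simp] theorem toInhomogeneous_isSteadyState :
    (P.toInhomogeneous N).IsSteadyState = P.IsSteadyState N := by
  funext T_L T_R μ; exact propext (P.toInhomogeneous_isSteadyState_iff N T_L T_R μ)

end SiteChain

namespace OscillatorChain

/-- A homogeneous chain as an inhomogeneous one: constant data, both couplings `γ`. [folklore] -/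
def toInhomogeneous (P : OscillatorChain) (N : ℕ) : InhomogeneousChain N :=
  ⟨fun _ => P.U, fun _ => P.V, P.γ, P.γ⟩

variable (P : OscillatorChain) (N : ℕ)

/-- The two embeddings commute with `toSiteChain`, definitionally. [folklore] -/
theorem toSiteChain_toInhomogeneous : P.toSiteChain.toInhomogeneous N = P.toInhomogeneous N := rfl

/-- Same Hamiltonian, definitionally. [folklore] -/
@[simp] theorem toInhomogeneous_hamiltonian : (P.toInhomogeneous N).hamiltonian = P.hamiltonian N :=
  rfl

/-- Same bond currents, definitionally. [folklore] -/
@[simp] theorem toInhomogeneous_bondCurrent : (P.toInhomogeneous N).bondCurrent = P.bondCurrent N :=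
  rfl

/-- Same total current, definitionally. [folklore] -/
@[simp] theorem toInhomogeneous_totalCurrent (μ : Measure (PhaseSpace N)) :
    (P.toInhomogeneous N).totalCurrent μ = P.totalCurrent μ := rfl

/-- Same generator. [folklore] -/
@[simp] theorem toInhomogeneous_generator : (P.toInhomogeneous N).generator = P.generator N :=
  P.toSiteChain.toInhomogeneous_generator N

/-- Same steady states. [folklore] -/
theorem toInhomogeneous_isSteadyState_iff (T_L T_R : ℝ) (μ : Measure (PhaseSpace N)) :
    (P.toInhomogeneous N).IsSteadyState T_L T_R μ ↔ P.IsSteadyState N T_L T_R μ :=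
  P.toSiteChain.toInhomogeneous_isSteadyState_iff N T_L T_R μ

/-- Same steady-state predicate (as functions). [folklore] -/
@[simp] theorem toInhomogeneous_isSteadyState :
    (P.toInhomogeneous N).IsSteadyState = P.IsSteadyState N :=
  P.toSiteChain.toInhomogeneous_isSteadyState N

end OscillatorChain

/-! ### (B) Chain environments, the bath map `Φ = attach`, the one-site conductance functional -/

/-- A CHAIN ENVIRONMENT: `k` oscillator sites `0, …, k-1` with pinning `U i`, interaction `V i` on
the bond `(i, i+1)` (`V ⟨k-1, _⟩` unused), whose last site `k-1` is coupled to a Langevin bath of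
coupling `γ` held at the environment's temperature; site `0` is the port at which further sites or
a Langevin contact are attached. The finite Markov realisations "`k` sites + Langevin bath" of the
thermal environments of the bath-renormalisation card (a CEHR network on a path with one bath
end, Cuneo–Eckmann–Hairer–Rey-Bellet 2018 §2 eq. (2.1)–(2.2); the port vocabulary itself is the
card's bookkeeping, not a published notion). [folklore] -/
structure ChainEnvironment where
  /-- number of sites -/
  k : ℕ
  /-- pinning potential of site `i` -/
  U : Fin k → ℝ → ℝ
  /-- interaction potential of the bond `(i, i+1)` -/
  V : Fin k → ℝ → ℝ
  /-- coupling of the Langevin bath on the far site `k - 1` -/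
  γ : ℝ

namespace ChainEnvironment

/-- The bare Langevin bath of coupling `γ` (no site; the `B_R` of the card). [folklore] -/
def bath (γ : ℝ) : ChainEnvironment := ⟨0, Fin.elim0, Fin.elim0, γ⟩

/-- The BATH MAP `Φ`: attach one site with pinning `U₀` in front of the port, bonded to the old
port site through `V₀`; the new site is the new port. [folklore] -/
def attach (U₀ V₀ : ℝ → ℝ) (E : ChainEnvironment) : ChainEnvironment :=
  ⟨E.k + 1, Fin.cons U₀ E.U, Fin.cons V₀ E.V, E.γ⟩

/-- The standard environment: `k` identical sites `(U₀, V₀)` in front of a bath `γ` (the orbit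
`Φ^k B_R`, see `iterate_attach_bath`). [folklore] -/
def standard (U₀ V₀ : ℝ → ℝ) (γ : ℝ) (k : ℕ) : ChainEnvironment := ⟨k, fun _ => U₀, fun _ => V₀, γ⟩

/-- Realise the environment as a chain by putting a Langevin CONTACT of coupling `γc` directly on
the port site `0` (the environment's own bath `γ` sits on site `k - 1`). [folklore] -/
def realiseWithContact (E : ChainEnvironment) (γc : ℝ) : InhomogeneousChain E.k :=
  ⟨E.U, E.V, γc, E.γ⟩

/-- The composite `[contact γc]–[site U₀]–V₀–E`: one standard thermostatted site in front of `E`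
(`E.k + 1` sites, `E.k` bonds). [folklore] -/
def composite (U₀ V₀ : ℝ → ℝ) (γc : ℝ) (E : ChainEnvironment) : InhomogeneousChain (E.k + 1) :=
  (E.attach U₀ V₀).realiseWithContact γc

/-- The ONE-SITE CONDUCTANCE FUNCTIONAL as a predicate, `g_T(E) = g`: for every family `μ T_L T_R`
of steady states of the composite over the bath temperatures `T_L, T_R > 0` (contact at `T_L`,
environment bath at `T_R`), the mean bond current at `(T + δ/2, T - δ/2)` divided by `δ` tends to
`g` as `δ → 0`, `δ ≠ 0` (linear-response DC conductance through one thermostatted site into `E` at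
temperature `T`; BLR (31)–(33) at fixed size). Vacuous for an `E` whose composite has no steady-state
family; unique as soon as one exists (`HasConductance.unique`). [cite: BonettoLebowitzReyBellet2000, §5.3 eq. (31)-(33)] -/
def HasConductance (U₀ V₀ : ℝ → ℝ) (γc T : ℝ) (E : ChainEnvironment) (g : ℝ) : Prop :=
  ∀ μ : ℝ → ℝ → Measure (PhaseSpace (E.k + 1)),
    (∀ T_L T_R : ℝ, 0 < T_L → 0 < T_R → (E.composite U₀ V₀ γc).IsSteadyState T_L T_R (μ T_L T_R)) →
    Tendsto (fun δ : ℝ => (E.composite U₀ V₀ γc).totalCurrent (μ (T + δ / 2) (T - δ / 2)) /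
      ((E.k : ℝ) * δ)) (𝓝[≠] 0) (𝓝 g)

/-- `E.IsStandardUpTo U₀ V₀ m`: `E` has at least `m` sites and its first `m` sites and bonds are
standard, `U i = U₀`, `V i = V₀` for `i < m`. [folklore] -/
def IsStandardUpTo (U₀ V₀ : ℝ → ℝ) (m : ℕ) (E : ChainEnvironment) : Prop :=
  m ≤ E.k ∧ ∀ i : Fin E.k, i.val < m → E.U i = U₀ ∧ E.V i = V₀

/-- The class `𝔅_T^{m, g₀}` of NEARLY CLOSED environments with a standard head: bath coupling
`γ > 0`, the first `m` sites/bonds standard, and every one-site conductance at `T` at most `g₀`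
(the domain of the route's junction-locality statements). Two vacuity effects of the predicate
form, to be kept in mind when quantifying over the class: an environment whose composite has NO
steady-state family admits every `g` as a conductance and is therefore EXCLUDED; an environment
whose composite has steady-state families but NO conductance (the current quotient does not
converge, or converges to different values along different families) satisfies the last clause
vacuously and is therefore INCLUDED — statements over `𝔅_T^{m,g₀}` that need a conductance must ask
for it (`∃ g, E.HasConductance U₀ V₀ γc T g`) or assume uniqueness of steady states. [folklore] -/
def nearlyClosed (U₀ V₀ : ℝ → ℝ) (γc T : ℝ) (m : ℕ) (g₀ : ℝ) : Set ChainEnvironment :=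
  {E | 0 < E.γ ∧ E.IsStandardUpTo U₀ V₀ m ∧ ∀ g : ℝ, E.HasConductance U₀ V₀ γc T g → g ≤ g₀}

/-! ### API: the bath map, the orbit identity, the class -/

section

variable (U₀ V₀ : ℝ → ℝ) (γ γc T : ℝ) (E : ChainEnvironment)

/-- The bare bath has no site. [folklore] -/
@[simp] theorem bath_k : (bath γ).k = 0 := rfl
/-- The bare bath's coupling. [folklore] -/
@[simp] theorem bath_γ : (bath γ).γ = γ := rfl
/-- `Φ` adds one site. [folklore] -/
@[simp] theorem attach_k : (E.attach U₀ V₀).k = E.k + 1 := rfl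
/-- `Φ` keeps the far bath. [folklore] -/
@[simp] theorem attach_γ : (E.attach U₀ V₀).γ = E.γ := rfl
/-- The new port site carries `U₀`. [folklore] -/
@[simp] theorem attach_U_zero : (E.attach U₀ V₀).U (0 : Fin (E.k + 1)) = U₀ :=
  Fin.cons_zero (α := fun _ => ℝ → ℝ) U₀ E.U
/-- The new port bond is `V₀`. [folklore] -/
@[simp] theorem attach_V_zero : (E.attach U₀ V₀).V (0 : Fin (E.k + 1)) = V₀ :=
  Fin.cons_zero (α := fun _ => ℝ → ℝ) V₀ E.V
/-- Old sites are shifted by one. [folklore] -/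
@[simp] theorem attach_U_succ (i : Fin E.k) : (E.attach U₀ V₀).U i.succ = E.U i :=
  Fin.cons_succ (α := fun _ => ℝ → ℝ) U₀ E.U i
/-- Old bonds are shifted by one. [folklore] -/
@[simp] theorem attach_V_succ (i : Fin E.k) : (E.attach U₀ V₀).V i.succ = E.V i :=
  Fin.cons_succ (α := fun _ => ℝ → ℝ) V₀ E.V i
/-- Size of the standard environment. [folklore] -/
@[simp] theorem standard_k (k : ℕ) : (standard U₀ V₀ γ k).k = k := rfl
/-- Bath of the standard environment. [folklore] -/
@[simp] theorem standard_γ (k : ℕ) : (standard U₀ V₀ γ k).γ = γ := rfl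
/-- Couplings of the composite: contact on the port, environment bath at the far end. [folklore] -/
@[simp] theorem composite_γL : (E.composite U₀ V₀ γc).γL = γc := rfl
/-- Couplings of the composite: contact on the port, environment bath at the far end. [folklore] -/
@[simp] theorem composite_γR : (E.composite U₀ V₀ γc).γR = E.γ := rfl

/-- The bare bath is the standard environment with no site. [folklore] -/
theorem bath_eq_standard : bath γ = standard U₀ V₀ γ 0 := by
  simp only [bath, standard]; congr <;> funext i <;> exact i.elim0

/-- One bath-map step along the orbit: `Φ (standard k) = standard (k+1)`. [folklore] -/
theorem attach_standard (k : ℕ) : (standard U₀ V₀ γ k).attach U₀ V₀ = standard U₀ V₀ γ (k + 1) := by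
  simp only [attach, standard]
  congr
  · exact Fin.cons_self_tail (fun _ : Fin (k + 1) => U₀)
  · exact Fin.cons_self_tail (fun _ : Fin (k + 1) => V₀)

/-- ORBIT of the bare bath under the bath map: `Φ^[n] B_R` is the standard `n`-site environment.
[folklore] -/
theorem iterate_attach_bath (n : ℕ) : (attach U₀ V₀)^[n] (bath γ) = standard U₀ V₀ γ n := by
  induction n with
  | zero => simpa using bath_eq_standard U₀ V₀ γ
  | succ n ih => rw [Function.iterate_succ_apply', ih, attach_standard]

/-- The composite in front of the standard `n`-site environment is the homogeneous `(n+1)`-chain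
with contact `γc` and far bath `γ`. [folklore] -/
theorem composite_standard' (n : ℕ) :
    (standard U₀ V₀ γ n).composite U₀ V₀ γc = ⟨fun _ => U₀, fun _ => V₀, γc, γ⟩ := by
  simp only [composite, realiseWithContact, attach, standard]
  congr
  · exact Fin.cons_self_tail (fun _ : Fin (n + 1) => U₀)
  · exact Fin.cons_self_tail (fun _ : Fin (n + 1) => V₀)

end

/-- ORBIT IDENTITY (objects): for a homogeneous chain `P`, the composite in front of
`Φ^[n] B_R = standard P.U P.V P.γ n` IS the `(n+1)`-site chain `P` (as an inhomogeneous chain).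
[folklore] -/
theorem composite_standard (P : OscillatorChain) (n : ℕ) :
    (standard P.U P.V P.γ n).composite P.U P.V P.γ = P.toInhomogeneous (n + 1) :=
  composite_standard' P.U P.V P.γ P.γ n

/-- ORBIT IDENTITY (conductance): along the orbit of the bare bath, `g_T(Φ^[n] B_R) = g` says exactly
that for every family of steady states of the homogeneous `(n+1)`-chain `P` over `T_L, T_R > 0`,
`totalCurrent (μ (T+δ/2) (T-δ/2)) / (n δ) → g` — the route's conductance `G_{n+1}` (for
`P = pinnedChain ω₂ lam β γ`: `G_N = D_N/(N-1)`, `N = n + 1 ≥ 2`). [folklore] -/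
theorem hasConductance_standard_iff (P : OscillatorChain) (T g : ℝ) (n : ℕ) :
    (standard P.U P.V P.γ n).HasConductance P.U P.V P.γ T g ↔
      ∀ μ : ℝ → ℝ → Measure (PhaseSpace (n + 1)),
        (∀ T_L T_R : ℝ, 0 < T_L → 0 < T_R → P.IsSteadyState (n + 1) T_L T_R (μ T_L T_R)) →
        Tendsto (fun δ : ℝ => P.totalCurrent (μ (T + δ / 2) (T - δ / 2)) / ((n : ℝ) * δ))
          (𝓝[≠] 0) (𝓝 g) := by
  simp only [HasConductance, composite_standard, OscillatorChain.toInhomogeneous_isSteadyState,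
    OscillatorChain.toInhomogeneous_totalCurrent, standard_k]
  exact Iff.rfl

/-- The same along the literal iterate `Φ^[n] (bath P.γ)`. [folklore] -/
theorem hasConductance_iterate_attach_bath_iff (P : OscillatorChain) (T g : ℝ) (n : ℕ) :
    ((attach P.U P.V)^[n] (bath P.γ)).HasConductance P.U P.V P.γ T g ↔
      ∀ μ : ℝ → ℝ → Measure (PhaseSpace (n + 1)),
        (∀ T_L T_R : ℝ, 0 < T_L → 0 < T_R → P.IsSteadyState (n + 1) T_L T_R (μ T_L T_R)) →
        Tendsto (fun δ : ℝ => P.totalCurrent (μ (T + δ / 2) (T - δ / 2)) / ((n : ℝ) * δ))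
          (𝓝[≠] 0) (𝓝 g) := by
  rw [iterate_attach_bath, hasConductance_standard_iff]

section

variable {U₀ V₀ : ℝ → ℝ} {γc T : ℝ} {E : ChainEnvironment}

/-- The conductance is unique once the composite has a family of steady states. [folklore] -/
theorem HasConductance.unique {g g' : ℝ} (hg : E.HasConductance U₀ V₀ γc T g)
    (hg' : E.HasConductance U₀ V₀ γc T g') (μ : ℝ → ℝ → Measure (PhaseSpace (E.k + 1)))
    (hμ : ∀ T_L T_R : ℝ, 0 < T_L → 0 < T_R →
      (E.composite U₀ V₀ γc).IsSteadyState T_L T_R (μ T_L T_R)) : g = g' :=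
  tendsto_nhds_unique (hg μ hμ) (hg' μ hμ)

/-- The bare bath (`k = 0`): the composite is one site without bond, the current quotient is the junk
`0`, so its conductance is `0` in this bookkeeping (the route uses `k ≥ 1` only). [folklore] -/
theorem hasConductance_bath (γ : ℝ) : (bath γ).HasConductance U₀ V₀ γc T 0 := by
  intro μ _
  simp only [bath_k, Nat.cast_zero, zero_mul, div_zero]
  exact tendsto_const_nhds

/-- The standard `n`-site environment has a standard head of any length `m ≤ n`. [folklore] -/
theorem isStandardUpTo_standard (γ : ℝ) {m n : ℕ} (h : m ≤ n) :
    (standard U₀ V₀ γ n).IsStandardUpTo U₀ V₀ m :=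
  ⟨h, fun _ _ => ⟨rfl, rfl⟩⟩

/-- The bath map lengthens a standard head by one. [folklore] -/
theorem IsStandardUpTo.attach {m : ℕ} (h : E.IsStandardUpTo U₀ V₀ m) :
    (E.attach U₀ V₀).IsStandardUpTo U₀ V₀ (m + 1) := by
  refine ⟨by simpa using h.1, fun i hi => ?_⟩
  induction i using Fin.cases with
  | zero => exact ⟨rfl, rfl⟩
  | succ j =>
    rw [attach_U_succ, attach_V_succ]
    exact h.2 j (by simpa [Fin.val_succ] using hi)

/-- Membership of the orbit in the class `𝔅_T^{m,g₀}`: a long enough standard environment is nearly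
closed iff its conductances are `≤ g₀`. [folklore] -/
theorem standard_mem_nearlyClosed_iff {γ : ℝ} {m n : ℕ} {g₀ : ℝ} (hγ : 0 < γ) (h : m ≤ n) :
    standard U₀ V₀ γ n ∈ nearlyClosed U₀ V₀ γc T m g₀ ↔
      ∀ g : ℝ, (standard U₀ V₀ γ n).HasConductance U₀ V₀ γc T g → g ≤ g₀ := by
  simp only [nearlyClosed, Set.mem_setOf_eq, standard_γ, hγ, isStandardUpTo_standard γ h, true_and]

end

end ChainEnvironment

end Literature.MathematicalPhysics.KineticTheory.HeatConduction
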